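import Summits.BirchSwinnertonDyer.BirchSwinnertonDyer.Theorems.KatoDescentPotSupersingularKatoFiniteLevelStrictFinal
import Summits.BirchSwinnertonDyer.Rank1Residual.Additive.AdicIntegersQuotientPrimePowCard
import Summits.BirchSwinnertonDyer.Rank1Residual.GaloisImage.FormalGroupLocalDivisibilityRat
import Literature.NumberTheory.EllipticCurves.Kato2004.LocPKummerLog
import HarnessLib

/-!
# Kato's (14.9.3) at finite level, part 7: the count OVER `ℚ` at `P = {p}` —
# `∃ k₀, ∀ k ≥ k₀: #H¹(ℤ[1/p], E[p^k]) = #Sel_str^{ur}(ℚ, E[p^∞]) · #E(ℚ_p)[p^k] · p^k`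
# (route `KatoDescentPotSupersingular` / `…Tame…`, crux M = stmt-BirchSwinnertonDyer-19196; route-free helper)

Seat `bsd-potss-rkm` g17 (prover; cell `bsd-potss`), item stmt-BirchSwinnertonDyer-19196 `ReducibleKatoMember`
(`--supports … --as helper`; closes nothing).  HONEST FRAMING: BSD is not proved by any of this; nothing is booked;
theorems only (no definition, no named fact).  Sequel of `…KatoFiniteLevelStrictFinal` (`∃ k₀ ∀ k ≥ k₀` over any
`K : Type`); here `K = ℚ`, `P = {v_p}` (`Kato2004.primePlace p`), the local factor evaluated:
`#𝓚_{v_p} = #E(ℚ_{v_p})[p^k] · #(ℤ_{v_p}/p^k) = #E(ℚ_{v_p})[p^k] · p^k` (Milne I Lemma 3.3 + `#(ℤ_p/p^k) = p^k`).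

## What

**`exists_forall_le_natCard_selmerGroup_relaxed_eq_rat`** — for `E/ℚ` elliptic, `p` an odd prime, a finite set `T ∋ v_p`
of places with good reduction outside `T`, and Kato's strict structure `𝓢∞` on `E[p^∞]` (zero at `v_p`, UNRAMIFIED at every
other prime) with `Sel_str^{ur}(ℚ, E[p^∞]) = H¹_{𝓢∞}` FINITE and `E(ℚ_p)[p^∞]` killed by some `p^{e_p}`: there is `k₀` such
that for every `k ≥ k₀`, every Poitou–Tate family `inv` at level `p^k` and every pair of Kato structures `𝓢 ≤ ℛ` on `E[p^k]`
(zero / everything at `v_p`, unramified at every other prime),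
**`#H¹_ℛ(ℚ, E[p^k]) = #Sel_str^{ur}(ℚ, E[p^∞]) · #E(ℚ_{v_p})[p^k] · p^k`** — Kato's `H¹(ℤ[1/p], E[p^k])` counted against
`Ker(H²(ℤ[1/p],T) → H²(ℚ_p,T))^∨ = Sel_str^{ur}(ℚ,E[p^∞])` ((14.9.3)/(14.9.4)) and `p^k·#E(ℚ_p)[p^∞]` (the rank-one growth of
`H¹(ℤ[1/p],T)/p^k` times `#H²(ℚ_p,T)` of (14.16.1)).

References: K. Kato, Astérisque 295 (2004) §8.2, (14.9.3)–(14.9.4), Prop. 14.16 [Kato2004Asterisque]; J. S. Milne, *ADT* I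
Lemma 3.3 [MilneADT2006].
-/

-- the summit and its single problem are both named `BirchSwinnertonDyer` (registry layout D-0017)
set_option linter.dupNamespace false
set_option autoImplicit false

noncomputable section

open scoped Classical ContRepresentation NumberField
open Function Field NumberField IsDedekindDomain WeierstrassCurve
open Literature.NumberTheory.EllipticCurves Literature.NumberTheory.GaloisRepresentations
  Literature.NumberTheory.GaloisRepresentations.DiscreteGaloisModule Literature.NumberTheory.GaloisCohomology
open Literature.NumberTheory.EllipticCurves.Kato2004
open Summit.BirchSwinnertonDyer.Rank1Residual.X11b.LocBridge
open Summit.BirchSwinnertonDyer.Rank1Residual.GaloisImage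

namespace Summit.BirchSwinnertonDyer.BirchSwinnertonDyer.Theorems.KatoFiniteLevelCount

section Rat

variable (W : WeierstrassCurve ℚ) [W.IsElliptic] (p : ℕ) [Fact p.Prime]

/-- A place of `ℚ` containing `p` is `v_p = primePlace p` (the finite places of `ℚ` are the primes). [folklore] -/
theorem eq_primePlace_of_natCast_mem {v : HeightOneSpectrum (𝓞 ℚ)} (hv : (p : 𝓞 ℚ) ∈ v.asIdeal) :
    v = primePlace p := by
  haveI : Fact (Rat.HeightOneSpectrum.primesEquiv v : ℕ).Prime := ⟨(Rat.HeightOneSpectrum.primesEquiv v).2⟩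
  have h : ((Rat.HeightOneSpectrum.primesEquiv v : Nat.Primes) : ℕ) = p :=
    (LocalDivisibility.natCast_mem_asIdeal_iff_eq v rfl (Fact.out : p.Prime)).mp hv
  apply (Rat.HeightOneSpectrum.primesEquiv (R := 𝓞 ℚ)).injective
  rw [primesEquiv_primePlace]
  exact Subtype.ext h

/-- `p ∉ v` for every place `v ≠ v_p` of `ℚ`. [folklore] -/
theorem natCast_not_mem_of_ne_primePlace {v : HeightOneSpectrum (𝓞 ℚ)} (hv : v ≠ primePlace p) :
    (p : 𝓞 ℚ) ∉ v.asIdeal :=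
  fun h => hv (eq_primePlace_of_natCast_mem p h)

/-- **The local factor at `v_p`: `#𝓚_{v_p} = #E(ℚ_{v_p})[p^k] · p^k`** (Milne I Lemma 3.3 `#E(K_v)/n = #E(K_v)[n]·#(𝓞_v/n)`,
tree `natCard_kummerSelmerStructure_inr`, and `#(ℤ_{v_p}/p^k) = p^k`, tree `natCard_quot_adicCompletionIntegers_prime_pow_rat`).
[cite: MilneADT2006, I Lemma 3.3] -/
theorem natCard_kummerSelmerStructure_primePlace (k : ℕ) :
    Nat.card (W.kummerSelmerStructure ((p ^ k : ℕ) : ℤ) (Sum.inr (primePlace p))) =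
      Nat.card (nsmulAddMonoidHom (p ^ k) :
          (W.baseChange ((primePlace p).adicCompletion ℚ)).toAffine.Point →+ _).ker * p ^ k := by
  haveI : NeZero (p ^ k) := ⟨pow_ne_zero k (Fact.out : p.Prime).ne_zero⟩
  rw [W.natCard_kummerSelmerStructure_inr (primePlace p) (NeZero.ne (p ^ k)),
    Rank1Residual.Additive.DefectCountFiniteLevel.natCard_quot_adicCompletionIntegers_prime_pow_rat (coe_primesEquiv_primePlace p) k]

/-- **Kato's (14.9.3) count over `ℚ` for all large levels.**  See the module docstring.
[cite: Kato2004Asterisque, (14.9.3)–(14.9.4) (p. 240) and Prop. 14.16 (p. 244)] [cite: MilneADT2006, I Lemma 3.3] -/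
theorem exists_forall_le_natCard_selmerGroup_relaxed_eq_rat (hodd : p ≠ 2) (T : Finset (HeightOneSpectrum (𝓞 ℚ)))
    (hpT : primePlace p ∈ T) (hT : ∀ v : HeightOneSpectrum (𝓞 ℚ), v ∉ T → W.HasGoodReductionAt v)
    (𝓢inf : SelmerStructure (primaryGaloisModule W p)) [Finite 𝓢inf.selmerGroup]
    (hIP : 𝓢inf (Sum.inr (primePlace p)) = ⊥)
    (hIur : ∀ v : HeightOneSpectrum (𝓞 ℚ), v ≠ primePlace p →
      𝓢inf (Sum.inr v) = unramifiedSubgroup (GaloisRep.toLocal v (primaryGaloisModule W p)) 1)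
    (hIinl : ∀ w : InfinitePlace ℚ, 𝓢inf (Sum.inl w) = ⊤)
    (heP : ∃ eP : ℕ, ∀ x : W.geomPrimaryTorsion p,
      (∀ σ : absoluteGaloisGroup ((primePlace p).adicCompletion ℚ),
        GaloisRep.toLocal (primePlace p) (primaryGaloisModule W p) σ x = x) → p ^ eP • x = 0) :
    ∃ k₀ : ℕ, ∀ k, k₀ ≤ k →
      ∀ (inv : LocalInvariants ℚ (p ^ k)), inv.IsPerfect → inv.SumLocalTermEqZero → inv.SelmerComplement →
      ∀ (𝓢 ℛ : SelmerStructure (W.torsionGaloisModule ((p ^ k : ℕ) : ℤ))),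
        𝓢 (Sum.inr (primePlace p)) = ⊥ → ℛ (Sum.inr (primePlace p)) = ⊤ →
        (∀ v : HeightOneSpectrum (𝓞 ℚ), v ≠ primePlace p →
          𝓢 (Sum.inr v) = unramifiedSubgroup (GaloisRep.toLocal v (W.torsionGaloisModule ((p ^ k : ℕ) : ℤ))) 1) →
        (∀ v : HeightOneSpectrum (𝓞 ℚ), v ≠ primePlace p →
          ℛ (Sum.inr v) = unramifiedSubgroup (GaloisRep.toLocal v (W.torsionGaloisModule ((p ^ k : ℕ) : ℤ))) 1) →
        Nat.card ℛ.selmerGroup =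
          Nat.card 𝓢inf.selmerGroup *
            (Nat.card (nsmulAddMonoidHom (p ^ k) :
              (W.baseChange ((primePlace p).adicCompletion ℚ)).toAffine.Point →+ _).ker * p ^ k) := by
  -- part 6 with `P = {v_p}`
  have hmemP : ∀ v : HeightOneSpectrum (𝓞 ℚ), v ∈ ({primePlace p} : Finset _) ↔ v = primePlace p := fun v =>
    Finset.mem_singleton
  obtain ⟨k₀, hk₀⟩ := exists_forall_le_natCard_selmerGroup_relaxed_eq W p hodd {primePlace p} T
    (Finset.singleton_subset_iff.2 hpT)
    (fun v hv => ⟨natCast_not_mem_of_ne_primePlace p (fun h => hv (h ▸ hpT)), hT v hv⟩)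
    (fun v hv => (hmemP v).2 (eq_primePlace_of_natCast_mem p hv)) 𝓢inf
    (fun v hv => by rw [(hmemP v).1 hv]; exact hIP)
    (fun v hv => hIur v (fun h => hv ((hmemP v).2 h))) hIinl
    (heP.imp fun eP h => fun v hv x hx => by
      have hv' := (hmemP v).1 hv
      subst hv'
      exact h x hx)
    ((hmemP _).2 rfl)
  refine ⟨k₀, fun k hk inv hperf hsum hcompl 𝓢 ℛ h𝓢P hℛP h𝓢ur hℛur => ?_⟩
  rw [hk₀ k hk inv hperf hsum hcompl 𝓢 ℛ (fun v hv => by rw [(hmemP v).1 hv]; exact h𝓢P)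
      (fun v hv => by rw [(hmemP v).1 hv]; exact hℛP) (fun v hv => h𝓢ur v (fun h => hv ((hmemP v).2 h)))
      (fun v hv => hℛur v (fun h => hv ((hmemP v).2 h))),
    Finset.prod_singleton, natCard_kummerSelmerStructure_primePlace]

end Rat

end Summit.BirchSwinnertonDyer.BirchSwinnertonDyer.Theorems.KatoFiniteLevelCount

end
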